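import Mathlib
import HarnessLib
import Summits.Ventures.LatticeQCDFlow.Exactness.SU2ClosedFormExponential
import Summits.Ventures.LatticeQCDFlow.Exactness.SU2WilsonFlowLOMember
import Literature.MathematicalPhysics.QuantumFieldTheory.Balaban1983to89.B10Eq18SigmaSU2
import Summits.Ventures.LatticeQCDFlow.Exactness.SU2KickPositiveJacobian

/-!
# Lüscher's log-det series for the `SU(2)` kick, in quaternion coordinates, sums to the closed-form Haar Jacobian the typed member books — poles included

HONEST FRAMING: exact (Metropolis-corrected) sampling algorithms for lattice gauge theory;
figures of merit are autocorrelation/cost numbers at stated couplings and volumes; no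
continuum-physics claim.

Venture `LatticeQCDFlow` (cell pub-lqcd), topic `Exactness`; FANOUT row 14 (`eng-flowhmc`, engine
`latflow.fthmc`, family B; `maps.wflow_substep_flat` / `resid_substep_flat`: the booked
`log|det J| = Σ_links log|det(1 + Φ_Q ∘ DQ)|` in left-invariant `su(N)` coordinates,
`Φ_Q = Σ_k (−1)^k ad_Q^k/(k+1)!`, `DQ[T] = −ε P(T U R)`).  NEW WORK of the cell; no number.
Literature used BY NAME: `Balaban1983to89.B13HaarSigma.phi` (`φ(a) = Σ aⁿ/(n+1)!` on a Banach
algebra) and `B10Eq18SigmaSU2` (`phi_eq_of_cube`, `hasSum_a`, `hasSum_b`, the cross-product matrix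
`crossMatrix` with `[v]_׳ = −|v|²[v]_×`).

The typed `SU(2)` members (`SU2WilsonFlowLOSubstep`, `SU2ResidualLayer`) book the closed-form
per-link density `(1 − κ cos θ)(sin(θ − κ sin θ)/sin θ)²` (E–S / `kickJac κ 2 θ`), repaired to
`(1 − κ cos θ)³` at the poles.  The engine books Lüscher's determinant.  This file proves, as pure
algebra, that the two agree:

* `det_crossMatrix_poly` — `det(α + β[v]_× + γ[v]_ײ) = α((α − γ|v|²)² + β²|v|²)` (any commutative
  ring);
* `quatVec_im_commutator` — the dictionary for `ad` on `su(2)` in the quaternion coordinates of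
  `HaarSU2Gaussian.lean`: `[quatVec(0,x), quatVec(0,y)] = quatVec(0, −2·[x]_× y)`;
  `luscherD_quatVec` — the differential of `U ↦ Q(U) = (c/2)(quatVec J · Uᴴ − h.c.)` along
  `T = quatVec(0,t)`, transported to the identity (`N = quatVec j`, `j = U⁻¹ ⋆ J`):
  `−(c/2)(N T + T Nᴴ) = quatVec(0, −c(j₀ − [j⃗]_×) t)`;
  hence (docstring) every power of `ad_Q` applied to `DQ[T]` — in particular Lüscher's `Φ_Q`
  (the engine truncates its series at `K` terms) — acts on quaternion coordinates as the same
  polynomial in `2c[j⃗]_×` times `D = −c(j₀ − [j⃗]_×)`;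
* **`det_one_add_phi_mul_luscherD`** — THE IDENTITY: for all real `c, j₀` and `j⃗ ∈ ℝ³`,
  `det(1 + φ(2c[j⃗]_×) · (−c)(j₀ − [j⃗]_×)) = (1 − c j₀)(cos(c m) − j₀ sin(c m)/m)²`, `m = |j⃗| ≠ 0`,
  and `= (1 − c j₀)³` for `j⃗ = 0` — with `‖J‖ cos θ = j₀`, `‖J‖ sin θ = m`, `κ = c‖J‖` this is
  `(1 − κ cos θ)(sin(θ − κ sin θ)/sin θ)²` off the poles and the repaired `(1 − κ cos θ)³` AT the
  poles: the number the engine books is the density the typed member certifies;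
* `lmulIso_inv_apply_zero` (`j₀ = ‖J‖ cos θ`, `θ = angle J (vecQuat U)`), `dotProduct_im_lmulIso_inv`
  (`|j⃗|² = ‖J‖² sin² θ`), and **`luscherDet_closedForm_eq_booked`** — in the engine's variables
  (link `U`, local field `J`, `j = U⁻¹ ⋆ J`) the closed form IS, branch by branch, the repaired
  per-link factor `if sin θ = 0 then (1 − c‖J‖ cos θ)³ else kickJac (c‖J‖) 2 θ` booked by
  `SU2KickPositiveJacobian.hasJacobian_su2Kick_fix` / `su2MaskedKick_certified`.

NOT CLAIMED: the general statement "Haar Jacobian of a smooth self-map of `SU(2)` = |det| of its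
left-trivialised differential" (standard Lie calculus, not in the tree — it is what makes Lüscher's
formula a Jacobian in the first place; here only the VALUE of his determinant is identified with the
certified density); the engine's truncation error of the `Φ` series; `SU(N ≥ 3)`; any number.
-/

noncomputable section

namespace Summit.Ventures.LatticeQCDFlow.Exactness

open Real WithLp Matrix
open Literature.MathematicalPhysics.QuantumFieldTheory.Balaban1983to89.B13HaarSigma (phi phi_zero)
open Literature.MathematicalPhysics.QuantumFieldTheory.Balaban1983to89.B10Eq18SigmaSU2
  (crossMatrix crossMatrix_sq crossMatrix_pow_three crossMatrix_mulVec phi_eq_of_cube hasSum_a hasSum_b)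
open scoped Matrix.Norms.Operator

/-! ## Determinant of a polynomial in the cross-product matrix -/

/-- `det(α·1 + β[v]_× + γ[v]_ײ) = α((α − γ|v|²)² + β²|v|²)` (eigenvalues `α` on the axis,
`(α − γ|v|²) ± iβ|v|` on the normal plane; here by brute force). -/
theorem det_crossMatrix_poly {R : Type*} [CommRing R] (v : Fin 3 → R) (α β γ : R) :
    (α • (1 : Matrix (Fin 3) (Fin 3) R) + β • crossMatrix v + γ • crossMatrix v ^ 2).det =
      α * ((α - γ * dotProduct v v) ^ 2 + β ^ 2 * dotProduct v v) := by
  rw [crossMatrix_sq]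
  simp [Matrix.det_fin_three, crossMatrix, dotProduct, Fin.sum_univ_three]
  ring

/-! ## The dictionary: `ad` and Lüscher's `DQ` in quaternion coordinates -/

/-- **`ad` on `su(2)` in quaternion coordinates is `−2 ×`**:
`quatVec(0,x) · quatVec(0,y) − quatVec(0,y) · quatVec(0,x) = quatVec(0, −2 [x]_× y)`. -/
theorem quatVec_im_commutator (x y : Fin 3 → ℝ) :
    quatVec (toLp 2 ![0, x 0, x 1, x 2]) * quatVec (toLp 2 ![0, y 0, y 1, y 2]) -
        quatVec (toLp 2 ![0, y 0, y 1, y 2]) * quatVec (toLp 2 ![0, x 0, x 1, x 2]) =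
      quatVec (toLp 2 ![0, ((-2 : ℝ) • (crossMatrix x).mulVec y) 0,
        ((-2 : ℝ) • (crossMatrix x).mulVec y) 1, ((-2 : ℝ) • (crossMatrix x).mulVec y) 2]) := by
  ext i j
  fin_cases i <;> fin_cases j <;> apply Complex.ext <;>
    simp [Matrix.mul_apply, Fin.sum_univ_two, Matrix.sub_apply, crossMatrix, dotProduct,
      Fin.sum_univ_three]
  all_goals ring

/-- **Lüscher's `DQ` in quaternion coordinates.**  With `N = quatVec j` (`j = (j₀, j⃗) = U⁻¹ ⋆ J`)
and `T = quatVec(0, t)`: `−(c/2)(N T + T Nᴴ) = quatVec(0, D t)` with `D = −c(j₀·1 − [j⃗]_×)` —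
the differential of `U ↦ (c/2)(quatVec J · Uᴴ − (quatVec J · Uᴴ)ᴴ)` along `U ↦ e^{sT} U`,
transported to the identity. -/
theorem luscherD_quatVec (c : ℝ) (j : R4) (t : Fin 3 → ℝ) :
    -((c / 2 : ℝ) : ℂ) • (quatVec j * quatVec (toLp 2 ![0, t 0, t 1, t 2]) +
        quatVec (toLp 2 ![0, t 0, t 1, t 2]) * (quatVec j)ᴴ) =
      quatVec (toLp 2 ![0,
        ((-c • ((j 0) • (1 : Matrix (Fin 3) (Fin 3) ℝ) - crossMatrix ![j 1, j 2, j 3])).mulVec t) 0,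
        ((-c • ((j 0) • (1 : Matrix (Fin 3) (Fin 3) ℝ) - crossMatrix ![j 1, j 2, j 3])).mulVec t) 1,
        ((-c • ((j 0) • (1 : Matrix (Fin 3) (Fin 3) ℝ) - crossMatrix ![j 1, j 2, j 3])).mulVec t) 2]) := by
  rw [← quatVec_negIm]
  ext i k
  fin_cases i <;> fin_cases k <;> apply Complex.ext <;>
    simp [Matrix.mul_apply, Fin.sum_univ_two, Matrix.add_apply, Matrix.smul_apply, crossMatrix,
      Matrix.mulVec, dotProduct, Fin.sum_univ_three, Matrix.sub_apply, Matrix.one_apply]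
  all_goals first | (right; ring) | ring

/-! ## The identity -/

/-- `|j⃗|²` cast to `ℂ`. -/
theorem dotProduct_ofReal (v : Fin 3 → ℝ) :
    dotProduct (fun i => (v i : ℂ)) (fun i => (v i : ℂ)) = ((dotProduct v v : ℝ) : ℂ) := by
  simp [dotProduct, Fin.sum_univ_three]

set_option backward.isDefEq.respectTransparency false in
/-- **Lüscher's determinant for the `SU(2)` kick equals the closed-form Haar density, poles
included.**  For all real `c, j₀` and `j⃗ : Fin 3 → ℝ` (`m² = j⃗·j⃗`), with `N = [j⃗]_×` cast to
`ℂ`: `det(1 + φ(2c N) · (−c)(j₀·1 − N))` equals `(1 − c j₀)³` if `j⃗ = 0` and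
`(1 − c j₀)(cos(c m) − j₀ sin(c m)/m)²` otherwise. -/
theorem det_one_add_phi_mul_luscherD (c j₀ : ℝ) (v : Fin 3 → ℝ) :
    ((1 : Matrix (Fin 3) (Fin 3) ℂ) +
        phi (((2 * c : ℝ) : ℂ) • crossMatrix (fun i => (v i : ℂ))) *
          (-(c : ℂ) • ((j₀ : ℂ) • (1 : Matrix (Fin 3) (Fin 3) ℂ) - crossMatrix (fun i => (v i : ℂ))))).det =
      if dotProduct v v = 0 then (((1 - c * j₀) ^ 3 : ℝ) : ℂ)
      else (((1 - c * j₀) * (Real.cos (c * √(dotProduct v v)) -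
        j₀ * Real.sin (c * √(dotProduct v v)) / √(dotProduct v v)) ^ 2 : ℝ) : ℂ) := by
  set N : Matrix (Fin 3) (Fin 3) ℂ := crossMatrix (fun i => (v i : ℂ)) with hN
  have hww : dotProduct (fun i => (v i : ℂ)) (fun i => (v i : ℂ)) = ((dotProduct v v : ℝ) : ℂ) :=
    dotProduct_ofReal v
  have hN3 : N ^ 3 = (-((dotProduct v v : ℝ) : ℂ)) • N := by
    rw [hN, crossMatrix_pow_three, hww]
  by_cases hm : dotProduct v v = 0
  · -- at the poles: `j⃗ = 0`, `N = 0`, the matrix is `(1 − c j₀)·1`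
    rw [if_pos hm]
    have hv : v = 0 := dotProduct_self_eq_zero.mp hm
    have hN0 : N = 0 := by
      rw [hN, hv]
      ext i j
      fin_cases i <;> fin_cases j <;> simp [crossMatrix]
    rw [hN0, smul_zero, phi_zero, sub_zero, one_mul, smul_smul, Matrix.det_fin_three]
    simp [Matrix.smul_apply]
    ring
  · rw [if_neg hm]
    have hm0 : 0 < dotProduct v v :=
      lt_of_le_of_ne (Finset.sum_nonneg fun i _ => mul_self_nonneg (v i)) (Ne.symm hm)
    set m : ℝ := √(dotProduct v v) with hmdef
    have hmpos : 0 < m := Real.sqrt_pos.2 hm0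
    have hm2 : dotProduct v v = m ^ 2 := (Real.sq_sqrt hm0.le).symm
    by_cases hc : c = 0
    · -- no kick: the matrix is `1`
      subst hc
      rw [show ((2 * (0 : ℝ) : ℝ) : ℂ) = 0 by push_cast; ring, zero_smul, phi_zero, one_mul,
        Complex.ofReal_zero, neg_zero, zero_smul, add_zero, Matrix.det_one]
      simp
    · -- main case: `φ(k) = 1 + a k + b k²` for `k = 2cN`, `k³ = −(2cm)² k`
      have hθ : 2 * c * m ≠ 0 := mul_ne_zero (mul_ne_zero two_ne_zero hc) hmpos.ne'
      have hk : (((2 * c : ℝ) : ℂ) • N) ^ 3 = (-(((2 * c * m : ℝ)) : ℂ) ^ 2) • (((2 * c : ℝ) : ℂ) • N) := by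
        rw [smul_pow, hN3, smul_smul, smul_smul, hm2]
        push_cast
        ring_nf
      have hphi := phi_eq_of_cube hk (hasSum_a hθ) (hasSum_b hθ)
      -- abbreviate the two tails
      set a : ℂ := (1 - Complex.cos ((2 * c * m : ℝ) : ℂ)) / ((2 * c * m : ℝ) : ℂ) ^ 2 with ha
      set b : ℂ := (((2 * c * m : ℝ) : ℂ) - Complex.sin ((2 * c * m : ℝ) : ℂ)) / ((2 * c * m : ℝ) : ℂ) ^ 3 with hb
      -- the matrix is a polynomial in `N`
      have hM : (1 : Matrix (Fin 3) (Fin 3) ℂ) + phi (((2 * c : ℝ) : ℂ) • N) *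
            (-(c : ℂ) • ((j₀ : ℂ) • (1 : Matrix (Fin 3) (Fin 3) ℂ) - N)) =
          (1 - (c : ℂ) * j₀) • (1 : Matrix (Fin 3) (Fin 3) ℂ) +
            ((c : ℂ) - 2 * a * c ^ 2 * j₀ - 4 * b * c ^ 3 * ((dotProduct v v : ℝ) : ℂ)) • N +
            (2 * a * (c : ℂ) ^ 2 - 4 * b * c ^ 3 * j₀) • N ^ 2 := by
        rw [hphi]
        have e1 : N * N = N ^ 2 := (pow_two N).symm
        have e2 : N ^ 2 * N = (-((dotProduct v v : ℝ) : ℂ)) • N := by rw [← pow_succ, hN3]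
        have e3 : N * (1 : Matrix (Fin 3) (Fin 3) ℂ) = N := mul_one N
        have e4 : N ^ 2 * (1 : Matrix (Fin 3) (Fin 3) ℂ) = N ^ 2 := mul_one _
        simp only [smul_pow, add_mul, mul_sub, Matrix.mul_smul, Matrix.smul_mul, one_mul, mul_one,
          smul_sub, smul_smul, e1, e2]
        push_cast
        module
      rw [hM, hN, det_crossMatrix_poly, hww, hm2]
      -- the scalar identity, over `ℂ`
      have hcos : Complex.cos ((2 * c * m : ℝ) : ℂ) = 1 - 2 * Complex.sin ((c : ℂ) * (m : ℂ)) ^ 2 := by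
        rw [show ((2 * c * m : ℝ) : ℂ) = 2 * ((c : ℂ) * (m : ℂ)) by push_cast; ring, Complex.cos_two_mul,
          Complex.cos_sq']
        ring
      have hsin : Complex.sin ((2 * c * m : ℝ) : ℂ) =
          2 * Complex.sin ((c : ℂ) * (m : ℂ)) * Complex.cos ((c : ℂ) * (m : ℂ)) := by
        rw [show ((2 * c * m : ℝ) : ℂ) = 2 * ((c : ℂ) * (m : ℂ)) by push_cast; ring, Complex.sin_two_mul]
      have hmC : ((m : ℝ) : ℂ) ≠ 0 := Complex.ofReal_ne_zero.mpr hmpos.ne'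
      have hcC : ((c : ℝ) : ℂ) ≠ 0 := Complex.ofReal_ne_zero.mpr hc
      set s : ℂ := Complex.sin ((c : ℂ) * (m : ℂ)) with hs
      set co : ℂ := Complex.cos ((c : ℂ) * (m : ℂ)) with hco
      have hsc : s ^ 2 + co ^ 2 = 1 := Complex.sin_sq_add_cos_sq _
      -- the two coefficients in closed form (no trigonometric identity needed)
      have hβ2 : ((c : ℂ) - 2 * a * c ^ 2 * j₀ - 4 * b * c ^ 3 * ((m ^ 2 : ℝ) : ℂ)) ^ 2 * ((m ^ 2 : ℝ) : ℂ) =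
          s ^ 2 * (co - (j₀ : ℂ) * s / m) ^ 2 := by
        rw [ha, hb, hcos, hsin]
        push_cast
        field_simp
        ring
      have hαγ : (1 - (c : ℂ) * j₀) - (2 * a * (c : ℂ) ^ 2 - 4 * b * c ^ 3 * j₀) * ((m ^ 2 : ℝ) : ℂ) =
          (1 - s ^ 2) - s * co * (j₀ : ℂ) / m := by
        rw [ha, hb, hcos, hsin]
        push_cast
        field_simp
        ring
      rw [hαγ, hβ2]
      push_cast
      rw [← hs, ← hco]
      linear_combination (-(1 - (c : ℂ) * (j₀ : ℂ)) * (-(co - (j₀ : ℂ) * s / (m : ℂ)) ^ 2 + 2 * co ^ 2 -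
        2 * (s * co * (j₀ : ℂ) / (m : ℂ)) - (s ^ 2 + co ^ 2 - 1))) * hsc


/-! ## In the engine's variables: the closed form is the booked (repaired) density -/

section Booked

open InnerProductGeometry
open scoped InnerProductSpace

/-- The transported field `j = U⁻¹ ⋆ J` has first coordinate `⟪J, vecQuat U⟫ = ‖J‖ cos θ`,
`θ = angle J (vecQuat U)`. -/
theorem lmulIso_inv_apply_zero (U : Matrix.specialUnitaryGroup (Fin 2) ℂ) (J : R4) :
    (lmulIso U⁻¹ J) 0 = ‖J‖ * Real.cos (angle J (vecQuat (U : Matrix (Fin 2) (Fin 2) ℂ))) := by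
  have h1 : ⟪lmulIso U⁻¹ J, lmulIso U⁻¹ (vecQuat (U : Matrix (Fin 2) (Fin 2) ℂ))⟫_ℝ =
      ⟪J, vecQuat (U : Matrix (Fin 2) (Fin 2) ℂ)⟫_ℝ := (lmulIso U⁻¹).inner_map_map _ _
  have h0 : lmulIso U⁻¹ (vecQuat (U : Matrix (Fin 2) (Fin 2) ℂ)) = EuclideanSpace.single 0 1 := by
    rw [← lmulIso_vecQuat_one U, lmulIso_inv_lmulIso, vecQuat_one]
  rw [h0, EuclideanSpace.inner_single_right] at h1
  simp only [one_mul, conj_trivial] at h1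
  rw [h1, inner_eq_norm_mul_cos_angle J (norm_vecQuat_of_mem U)]

/-- … and its imaginary part has squared length `‖J‖² sin² θ`. -/
theorem dotProduct_im_lmulIso_inv (U : Matrix.specialUnitaryGroup (Fin 2) ℂ) (J : R4) :
    dotProduct ![(lmulIso U⁻¹ J) 1, (lmulIso U⁻¹ J) 2, (lmulIso U⁻¹ J) 3]
        ![(lmulIso U⁻¹ J) 1, (lmulIso U⁻¹ J) 2, (lmulIso U⁻¹ J) 3] =
      (‖J‖ * Real.sin (angle J (vecQuat (U : Matrix (Fin 2) (Fin 2) ℂ)))) ^ 2 := by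
  have hn : ‖lmulIso U⁻¹ J‖ ^ 2 = ‖J‖ ^ 2 := by rw [LinearIsometryEquiv.norm_map]
  rw [EuclideanSpace.real_norm_sq_eq, Fin.sum_univ_four, lmulIso_inv_apply_zero] at hn
  have hs : Real.sin (angle J (vecQuat (U : Matrix (Fin 2) (Fin 2) ℂ))) ^ 2 =
      1 - Real.cos (angle J (vecQuat (U : Matrix (Fin 2) (Fin 2) ℂ))) ^ 2 := Real.sin_sq _
  simp only [dotProduct, Fin.sum_univ_three, Matrix.cons_val_zero, Matrix.cons_val_one,
    Matrix.cons_val]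
  nlinarith [hn, hs]

/-- **The engine's determinant, evaluated at a link `U` and local field `J`, is the repaired
closed-form density booked by the typed members.**  With `j = U⁻¹ ⋆ J`, `j₀ = j 0`,
`j⃗ = (j 1, j 2, j 3)`: the value of `det_one_add_phi_mul_luscherD c j₀ j⃗` equals
`(1 − c‖J‖ cos θ)³` if `sin θ = 0` and `kickJac (c‖J‖) 2 θ` otherwise, `θ = angle J (vecQuat U)` —
literally the per-link factor of `SU2KickPositiveJacobian.hasJacobian_su2Kick_fix` /
`su2MaskedKick_certified`. -/
theorem luscherDet_closedForm_eq_booked (c : ℝ) (U : Matrix.specialUnitaryGroup (Fin 2) ℂ) (J : R4) :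
    (if dotProduct ![(lmulIso U⁻¹ J) 1, (lmulIso U⁻¹ J) 2, (lmulIso U⁻¹ J) 3]
          ![(lmulIso U⁻¹ J) 1, (lmulIso U⁻¹ J) 2, (lmulIso U⁻¹ J) 3] = 0 then
        (1 - c * (lmulIso U⁻¹ J) 0) ^ 3
      else (1 - c * (lmulIso U⁻¹ J) 0) *
        (Real.cos (c * √(dotProduct ![(lmulIso U⁻¹ J) 1, (lmulIso U⁻¹ J) 2, (lmulIso U⁻¹ J) 3]
            ![(lmulIso U⁻¹ J) 1, (lmulIso U⁻¹ J) 2, (lmulIso U⁻¹ J) 3])) -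
          (lmulIso U⁻¹ J) 0 * Real.sin (c * √(dotProduct ![(lmulIso U⁻¹ J) 1, (lmulIso U⁻¹ J) 2, (lmulIso U⁻¹ J) 3]
            ![(lmulIso U⁻¹ J) 1, (lmulIso U⁻¹ J) 2, (lmulIso U⁻¹ J) 3])) /
            √(dotProduct ![(lmulIso U⁻¹ J) 1, (lmulIso U⁻¹ J) 2, (lmulIso U⁻¹ J) 3]
              ![(lmulIso U⁻¹ J) 1, (lmulIso U⁻¹ J) 2, (lmulIso U⁻¹ J) 3])) ^ 2) =
      (if Real.sin (angle J (vecQuat (U : Matrix (Fin 2) (Fin 2) ℂ))) = 0 then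
          (1 - c * ‖J‖ * Real.cos (angle J (vecQuat (U : Matrix (Fin 2) (Fin 2) ℂ)))) ^ 3
        else kickJac (c * ‖J‖) 2 (angle J (vecQuat (U : Matrix (Fin 2) (Fin 2) ℂ)))) := by
  set θ : ℝ := angle J (vecQuat (U : Matrix (Fin 2) (Fin 2) ℂ)) with hθ
  rw [dotProduct_im_lmulIso_inv, lmulIso_inv_apply_zero]
  have hsin0 : 0 ≤ Real.sin θ := Real.sin_nonneg_of_nonneg_of_le_pi (angle_nonneg _ _) (angle_le_pi _ _)
  rcases eq_or_ne J 0 with rfl | hJ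
  · -- no field: both sides are `1`
    have hθ2 : θ = π / 2 := by rw [hθ, angle_zero_left]
    simp [hθ2, kickJac, kickAngle_apply]
  have hJn : ‖J‖ ≠ 0 := norm_ne_zero_iff.2 hJ
  by_cases hs : Real.sin θ = 0
  · rw [if_pos (by rw [hs, mul_zero, sq, mul_zero]), if_pos hs]
    ring
  · have hspos : 0 < Real.sin θ := lt_of_le_of_ne hsin0 (Ne.symm hs)
    have hne : (‖J‖ * Real.sin θ) ^ 2 ≠ 0 := pow_ne_zero 2 (mul_ne_zero hJn hs)
    rw [if_neg hne, if_neg hs, Real.sqrt_sq (mul_nonneg (norm_nonneg J) hsin0), kickJac,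
      kickAngle_apply, Real.sin_sub]
    field_simp
    ring

end Booked

end Summit.Ventures.LatticeQCDFlow.Exactness
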